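import Summits.BirchSwinnertonDyer.BirchSwinnertonDyer.Theorems.PrintCf2SplitBadTwoLevelProjRangeCount
import HarnessLib

/-!
# Crux `PrintCf2.SplitBadTwoRankOneOfFacts` (stmt-BirchSwinnertonDyer-20368), road α v10.3, S3c input (F3): the Option-A‴ MASTER LOCAL IDENTITY
# `[H¹_{𝓕[⊤ at v]} : H¹_𝓕] · #loc_v(H¹_{𝓕*}) · #(N^E_v)_e = #E(K_v)[p^N] · #(𝓞_v ⧸ p^N)`

Cell `bsd-print-cf2`, EXTRA WIDTH seat `bsd-line-cf2-p1-w4` g9 (prover-bsd-line-cf2-p1-w4-g9-0); `--supports stmt-BirchSwinnertonDyer-20368`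
(helper, Theses-free). HONEST FRAMING: nothing here closes the crux or a registered stub; BSD is not proved by any of this; no summit
statement is proved by this seat. No definition, no named fact, no `sorry`. Combines this seat's p675947 (`relIndex_selmerGroup_update_top_mul_eq_sq`:
`[𝓖 : 𝓕] · #loc_v(H¹_{𝓕*}) · #𝓕_v = #H¹(K_v, E[p^N]) = s²`, `s = #E(K_v)[p^N] · #(𝓞_v ⧸ p^N)`) and p677803 (`natCard_range_map_levelProj_eq`: `#A = s` for
the `e`-part `A = H¹(ẽ_N)(H¹(K_v, E[p^N]))` of an isotropic splitting) with the elementary count `#(N.comap f) · #f(H) = #(N ∩ f(H)) · #H` for a splitting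
`f + g = 1`, `f² = f` of a finite abelian group (§1), for Option A‴'s local condition `𝓕_v = L_v = (N^E_v).comap H¹(ẽ_N)`.

WHAT. §1 `natCard_comap_mul_natCard_range_eq` (pure algebra). §2 `map_levelProj_idem` (`H¹(ẽ_N)² = H¹(ẽ_N)` for idempotent `ẽ_N`).
§3 **`relIndex_selmerGroup_update_top_mul_eq_of_levelProj`**: for `𝓕` torsion-strict away from `v` with
`𝓕 (Sum.inr v) = (N^E_v).comap (map (eN.restrictField (v.adicCompletion K)) 1)` (-w5 g3 p677230's `h𝓕v`), an isotropic splitting `ẽ_N + ẽ′_N = 1`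
(p677924 `exists_isotropic_levelSplitting_of_frame`), the level-`p^N` Poitou–Tate family, `T ⊇ ∞ ∪ {w ∣ p} ∪ {bad} ∋ v`, `N ≥ 1`:
  **`[H¹_{𝓕[⊤ at v]} : H¹_𝓕] · #loc_v(H¹_{𝓕*}(K, E[p^N]^D)) · #(N^E_v ⊓ A) = #E(K_v)[p^N] · #(𝓞_v ⧸ p^N)`.**
With p677230 (`[H¹_{𝓕[⊤ at v]} : H¹_𝓕] = #range(loc_v | 𝔖_{v̄}(K, W*))`) this is «`#image_v · #loc_v(G′_N) · #(N^E_v)_e = #E(K_v)[2^N] · 2^N`» of the (F3) plan.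
presearch: Howard 2004 Thm. 2.1.11 / Milne ADT I Thm. 4.10, 2.8, Cor. 2.3 → tree theorems (this seat's p675312/p675947/p677803); no new fact. beyond-print theorem: no.

References: [MilneADT2006] I Cor. 2.3, Thm. 2.8, Thm. 4.10; [Howard2004HeegnerKolyvagin] Thm. 2.1.11; [Rubin1999] §2.
-/

noncomputable section

open scoped Classical

set_option linter.dupNamespace false
set_option autoImplicit false

open Function Field NumberField IsDedekindDomain WeierstrassCurve
open Literature.NumberTheory.EllipticCurves
open Literature.NumberTheory.GaloisRepresentations
open Literature.NumberTheory.GaloisRepresentations.DiscreteGaloisModule (localTatePairingZMod tateDual SelmerStructure mu)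
open Literature.NumberTheory.GaloisCohomology
open Literature.NumberTheory.GaloisCohomology.LocalInvariants
open scoped ContRepresentation
open Summit.BirchSwinnertonDyer.Rank1Residual.X11b
open Summit.BirchSwinnertonDyer.Rank1Residual.X11b.LocBridge
open Summit.BirchSwinnertonDyer.Rank1Residual.X11b.Relaxation

namespace Summit.BirchSwinnertonDyer.BirchSwinnertonDyer.Theorems.PrintCf2.RestrictedSelmerPair

/-! ## §1. Pure algebra: `#(N.comap f) · #f(H) = #(N ∩ f(H)) · #H` for a splitting `f + g = 1`, `f² = f` -/

section Algebra

variable {H : Type*} [AddCommGroup H]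

/-- **`#(N.comap f) · #f(H) = #(N ∩ f(H)) · #H`** for endomorphisms `f, g` of a finite abelian group with `f + g = 1` and `f ∘ f = f`, and any subgroup `N`:
`H ≅ f(H) × g(H)` via `x ↦ (f x, g x)`, under which `N.comap f ≅ (N ∩ f(H)) × g(H)`. [folklore] -/
theorem natCard_comap_mul_natCard_range_eq [Finite H] (f g : H →+ H) (hfg : ∀ x, f x + g x = x) (hff : ∀ x, f (f x) = f x)
    (N : AddSubgroup H) :
    Nat.card (N.comap f) * Nat.card f.range = Nat.card (N ⊓ f.range : AddSubgroup H) * Nat.card H := by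
  -- `f ∘ g = 0`, `g ∘ g = g`, `f` fixes its range
  have hg : ∀ x, g x = x - f x := fun x ↦ by rw [eq_sub_iff_add_eq, add_comm, hfg]
  have hfg0 : ∀ x, f (g x) = 0 := fun x ↦ by rw [hg, map_sub, hff, sub_self]
  have hgf0 : ∀ x, g (f x) = 0 := fun x ↦ by rw [hg, hff, sub_self]
  have hgg : ∀ x, g (g x) = g x := fun x ↦ by
    conv_lhs => rw [hg x, map_sub, hgf0, sub_zero]
  have hfr : ∀ a : f.range, f a = a := fun a ↦ by obtain ⟨x, hx⟩ := a.2; rw [← hx, hff]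
  have hgr : ∀ b : g.range, g b = b := fun b ↦ by obtain ⟨x, hx⟩ := b.2; rw [← hx, hgg]
  have hfgr : ∀ b : g.range, f b = 0 := fun b ↦ by obtain ⟨x, hx⟩ := b.2; rw [← hx, hfg0]
  have hgfr : ∀ a : f.range, g a = 0 := fun a ↦ by obtain ⟨x, hx⟩ := a.2; rw [← hx, hgf0]
  -- `H ≅ f(H) × g(H)`
  have hH : Nat.card H = Nat.card f.range * Nat.card g.range := by
    rw [← Nat.card_prod]
    refine Nat.card_eq_of_bijective (fun x ↦ (⟨f x, ⟨x, rfl⟩⟩, ⟨g x, ⟨x, rfl⟩⟩)) ⟨fun x y hxy ↦ ?_, fun ab ↦ ?_⟩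
    · have h1 := congrArg (fun q : f.range × g.range ↦ (q.1 : H) + (q.2 : H)) hxy
      simpa only [hfg] using h1
    · refine ⟨(ab.1 : H) + (ab.2 : H), Prod.ext (Subtype.ext ?_) (Subtype.ext ?_)⟩
      · change f ((ab.1 : H) + (ab.2 : H)) = ab.1
        rw [map_add, hfr, hfgr, add_zero]
      · change g ((ab.1 : H) + (ab.2 : H)) = ab.2
        rw [map_add, hgfr, hgr, zero_add]
  -- `N.comap f ≅ (N ∩ f(H)) × g(H)`
  have hC : Nat.card (N.comap f) = Nat.card (N ⊓ f.range : AddSubgroup H) * Nat.card g.range := by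
    rw [← Nat.card_prod]
    refine Nat.card_eq_of_bijective
      (fun x ↦ (⟨f x, AddSubgroup.mem_inf.mpr ⟨x.2, ⟨x, rfl⟩⟩⟩, ⟨g x, ⟨x, rfl⟩⟩)) ⟨fun x y hxy ↦ ?_, fun ab ↦ ?_⟩
    · have h1 := congrArg (fun q : (N ⊓ f.range : AddSubgroup H) × g.range ↦ (q.1 : H) + (q.2 : H)) hxy
      exact Subtype.ext (by simpa only [hfg] using h1)
    · have hmem : (ab.1 : H) + (ab.2 : H) ∈ N.comap f := by
        rw [AddSubgroup.mem_comap, map_add, hfr ⟨ab.1, (AddSubgroup.mem_inf.mp ab.1.2).2⟩, hfgr, add_zero]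
        exact (AddSubgroup.mem_inf.mp ab.1.2).1
      refine ⟨⟨(ab.1 : H) + (ab.2 : H), hmem⟩, Prod.ext (Subtype.ext ?_) (Subtype.ext ?_)⟩
      · change f ((ab.1 : H) + (ab.2 : H)) = ab.1
        rw [map_add, hfr ⟨ab.1, (AddSubgroup.mem_inf.mp ab.1.2).2⟩, hfgr, add_zero]
      · change g ((ab.1 : H) + (ab.2 : H)) = ab.2
        rw [map_add, hgfr ⟨ab.1, (AddSubgroup.mem_inf.mp ab.1.2).2⟩, hgr, zero_add]
  rw [hC, hH]
  ring

end Algebra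

/-! ## §2. `H¹(ẽ_N)` is idempotent -/

section Idem

variable {F : Type} [Field F] (V : WeierstrassCurve F) (p N : ℕ) (E : Type) [Field E] [Algebra F E]

/-- **`H¹(ẽ_N) ∘ H¹(ẽ_N) = H¹(ẽ_N)`** over any `F`-field for an idempotent equivariant endomorphism `ẽ_N` of `E[p^N]` (on cocycles).
[cite: SerreGaloisCohomology1997, I §2.4] -/
theorem map_levelProj_idem
    (eN : (V.torsionGaloisModule ((p ^ N : ℕ) : ℤ)).toContRepresentation →ⁱL (V.torsionGaloisModule ((p ^ N : ℕ) : ℤ)).toContRepresentation)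
    (hidem : ∀ x, eN (eN x) = eN x)
    (a : galoisCohomology (GaloisRep.restrictField E (V.torsionGaloisModule ((p ^ N : ℕ) : ℤ))) 1) :
    galoisCohomology.map (eN.restrictField E) 1 (galoisCohomology.map (eN.restrictField E) 1 a) =
      galoisCohomology.map (eN.restrictField E) 1 a := by
  obtain ⟨φ, rfl⟩ := oneCocycleClass_surjective _ a
  rw [galoisCohomology.map_one_oneCocycleClass, galoisCohomology.map_one_oneCocycleClass]
  congr 1
  refine Subtype.ext (ContinuousMap.ext fun σ ↦ ?_)
  exact hidem (φ.1 σ)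

end Idem

/-! ## §3. The master identity -/

section Master

variable {K : Type} [Field K] [NumberField K] (W : WeierstrassCurve K) [W.IsElliptic] (p : ℕ) [hp : Fact p.Prime] (N : ℕ)
  [NeZero (p ^ N)] [Finite (W.geomTorsion ((p ^ N : ℕ) : ℤ))]
variable (e : W.geomTorsion ((p ^ N : ℕ) : ℤ) → W.geomTorsion ((p ^ N : ℕ) : ℤ) → AlgebraicClosure K)
  (hμ : ∀ S T, e S T ^ (p ^ N) = 1)
  (hadd₁ : ∀ S₁ S₂ T, e (S₁ + S₂) T = e S₁ T * e S₂ T)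
  (hadd₂ : ∀ S T₁ T₂, e S (T₁ + T₂) = e S T₁ * e S T₂)
  (hgal : ∀ (σ : absoluteGaloisGroup K) (S T : W.geomTorsion ((p ^ N : ℕ) : ℤ)), σ • e S T = e (σ • S) (σ • T))
  (hnondeg : ∀ T, (∀ S, e S T = 1) → T = 0)
  {inv : LocalInvariants K (p ^ N)}

include hgal hnondeg in
/-- **Option-A‴ master local identity: `[H¹_{𝓕[⊤ at v]} : H¹_𝓕] · #loc_v(H¹_{𝓕*}(K, E[p^N]^D)) · #(N^E_v ⊓ A) = #E(K_v)[p^N] · #(𝓞_v ⧸ p^N)`**,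
`A = H¹(ẽ_N)(H¹(K_v, E[p^N]))`, for the torsion-strict structure `𝓕` with `𝓕_v = (N^E_v).comap H¹(ẽ_N)` and an isotropic splitting `ẽ_N + ẽ′_N = 1`
(p675947 × p677803 × §1, square root taken; hypotheses as there). With -w5 g3 p677230 the first factor is `#range(loc_v | 𝔖_{v̄}(K, W*))`.
[cite: MilneADT2006, I Thm. 4.10, Thm. 2.8, Cor. 2.3] [cite: Howard2004HeegnerKolyvagin, Thm. 2.1.11 (arXiv:1202.6340 p. 6)] [cite: Rubin1999, §2] -/
theorem relIndex_selmerGroup_update_top_mul_eq_of_levelProj (hN : 0 < N) (hperf : inv.IsPerfect) (hvan : inv.SumLocalTermEqZero)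
    (hcomp : inv.SelmerComplement) (T : Finset (Place K)) (hinf : ∀ w : InfinitePlace K, (Sum.inl w : Place K) ∈ T)
    (hpT : ∀ w : HeightOneSpectrum (𝓞 K), ((p : ℕ) : 𝓞 K) ∈ w.asIdeal → (Sum.inr w : Place K) ∈ T)
    (hbad : ∀ w : HeightOneSpectrum (𝓞 K), ¬ W.HasGoodReductionAt w → (Sum.inr w : Place K) ∈ T)
    (v : HeightOneSpectrum (𝓞 K)) (hv : (Sum.inr v : Place K) ∈ T)
    (eN eN' : (W.torsionGaloisModule ((p ^ N : ℕ) : ℤ)).toContRepresentation →ⁱL (W.torsionGaloisModule ((p ^ N : ℕ) : ℤ)).toContRepresentation)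
    (hsum : ∀ x, eN x + eN' x = x) (hidem : ∀ x, eN (eN x) = eN x)
    (hiso : ∀ x y, weilPairingHom W (p ^ N) e hμ hadd₁ hadd₂ (eN x) (eN y) = 0)
    (hiso' : ∀ x y, weilPairingHom W (p ^ N) e hμ hadd₁ hadd₂ (eN' x) (eN' y) = 0)
    (𝓕 : SelmerStructure (W.torsionGaloisModule ((p ^ N : ℕ) : ℤ)))
    (h𝓕 : ∀ w : HeightOneSpectrum (𝓞 K), w ≠ v →
      𝓕 (Sum.inr w) = (galoisCohomology.map ((Levels.primaryInclusion W p N).restrictField (w.adicCompletion K)) 1).ker)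
    (h𝓕v : 𝓕 (Sum.inr v) = ((galoisCohomology.map ((Levels.primaryInclusion W p N).restrictField (v.adicCompletion K)) 1).ker).comap
      (galoisCohomology.map (eN.restrictField (v.adicCompletion K)) 1)) :
    𝓕.selmerGroup.relIndex (SelmerStructure.selmerGroup (Function.update 𝓕 (Sum.inr v : Place K) ⊤)) *
        Nat.card ((inv.dualSelmerStructure (W.torsionGaloisModule ((p ^ N : ℕ) : ℤ)) 𝓕).selmerGroup.map
          (galoisCohomology.localization ((W.torsionGaloisModule ((p ^ N : ℕ) : ℤ)).tateDual (p ^ N)) (Sum.inr v : Place K) 1)) *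
        Nat.card (((galoisCohomology.map ((Levels.primaryInclusion W p N).restrictField (v.adicCompletion K)) 1).ker ⊓
          (galoisCohomology.map (eN.restrictField (v.adicCompletion K)) 1).range : AddSubgroup _)) =
      Nat.card (nsmulAddMonoidHom (p ^ N) : (W.baseChange (v.adicCompletion K)).toAffine.Point →+ _).ker *
        Nat.card (v.adicCompletionIntegers K ⧸ Ideal.span {((p ^ N : ℕ) : v.adicCompletionIntegers K)}) := by
  haveI hfin : Finite (galoisCohomology (GaloisRep.restrictField (v.adicCompletion K) (W.torsionGaloisModule ((p ^ N : ℕ) : ℤ))) 1) :=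
    KummerPT.finite_galoisCohomology_toLocal_inr W (p ^ N) v
  -- (i) p675947: `[𝓖 : 𝓕] · #loc · #𝓕_v = s²`
  have h1 := relIndex_selmerGroup_update_top_mul_eq_sq W p N hN hperf hvan hcomp T hinf hpT hbad v hv 𝓕 h𝓕
  rw [h𝓕v] at h1
  -- (ii) p677803: `#A = s`
  have h2 : Nat.card (galoisCohomology.map (eN.restrictField (v.adicCompletion K)) 1).range =
      Nat.card (nsmulAddMonoidHom (p ^ N) : (W.baseChange (v.adicCompletion K)).toAffine.Point →+ _).ker *
        Nat.card (v.adicCompletionIntegers K ⧸ Ideal.span {((p ^ N : ℕ) : v.adicCompletionIntegers K)}) :=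
    natCard_range_map_levelProj_eq W p N e hμ hadd₁ hadd₂ hgal hnondeg inv hN v (hperf v).1.1 eN eN' hsum hiso hiso'
  -- (iii) `#H¹ = s²` and §1: `#𝓕_v · #A = #(N ⊓ A) · #H¹`
  have hpp : IsPrimePow (p ^ N) := ⟨p, N, hp.out.prime, hN, rfl⟩
  have hH : Nat.card (galoisCohomology (GaloisRep.restrictField (v.adicCompletion K) (W.torsionGaloisModule ((p ^ N : ℕ) : ℤ))) 1) =
      (Nat.card (nsmulAddMonoidHom (p ^ N) : (W.baseChange (v.adicCompletion K)).toAffine.Point →+ _).ker *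
        Nat.card (v.adicCompletionIntegers K ⧸ Ideal.span {((p ^ N : ℕ) : v.adicCompletionIntegers K)})) ^ 2 :=
    natCard_galoisCohomology_one_torsion_adicCompletion_eq_sq W v (p ^ N) hpp (localEulerPoincareCharacteristic_adicCompletion_of_numberField v)
  have h3 := natCard_comap_mul_natCard_range_eq (galoisCohomology.map (eN.restrictField (v.adicCompletion K)) 1)
    (galoisCohomology.map (eN'.restrictField (v.adicCompletion K)) 1)
    (fun a ↦ LevelEigen.map_restrictField_add_map_restrictField_eq W p N (v.adicCompletion K) eN eN' hsum a)
    (fun a ↦ map_levelProj_idem W p N (v.adicCompletion K) eN hidem a)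
    (galoisCohomology.map ((Levels.primaryInclusion W p N).restrictField (v.adicCompletion K)) 1).ker
  rw [hH, h2] at h3
  -- arithmetic: `R·L·Fv = s²`, `Fv·s = C·s²` ⟹ `R·L·C = s`
  set s := Nat.card (nsmulAddMonoidHom (p ^ N) : (W.baseChange (v.adicCompletion K)).toAffine.Point →+ _).ker *
    Nat.card (v.adicCompletionIntegers K ⧸ Ideal.span {((p ^ N : ℕ) : v.adicCompletionIntegers K)}) with hs
  set R := 𝓕.selmerGroup.relIndex (SelmerStructure.selmerGroup (Function.update 𝓕 (Sum.inr v : Place K) ⊤)) with hR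
  set L := Nat.card ((inv.dualSelmerStructure (W.torsionGaloisModule ((p ^ N : ℕ) : ℤ)) 𝓕).selmerGroup.map
    (galoisCohomology.localization ((W.torsionGaloisModule ((p ^ N : ℕ) : ℤ)).tateDual (p ^ N)) (Sum.inr v : Place K) 1)) with hL
  set Fv := Nat.card (((galoisCohomology.map ((Levels.primaryInclusion W p N).restrictField (v.adicCompletion K)) 1).ker).comap
    (galoisCohomology.map (eN.restrictField (v.adicCompletion K)) 1)) with hFv
  set C := Nat.card (((galoisCohomology.map ((Levels.primaryInclusion W p N).restrictField (v.adicCompletion K)) 1).ker ⊓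
    (galoisCohomology.map (eN.restrictField (v.adicCompletion K)) 1).range : AddSubgroup _)) with hC
  have hspos : 0 < s := by
    rw [← h2]
    exact Nat.card_pos
  -- `h1` lives on the `toLocal (Sum.inr v)` spelling of `H¹(K_v, ·)`; restate it on `Fv` (definitionally equal)
  have h1' : R * L * Fv = s ^ 2 := h1
  have h3' : Fv * s = C * s ^ 2 := h3
  have key : R * L * C * s ^ 2 = s * s ^ 2 := by
    calc R * L * C * s ^ 2 = R * L * (C * s ^ 2) := by ring
      _ = R * L * (Fv * s) := by rw [h3']
      _ = (R * L * Fv) * s := by ring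
      _ = s ^ 2 * s := by rw [h1']
      _ = s * s ^ 2 := by ring
  exact Nat.eq_of_mul_eq_mul_right (pow_pos hspos 2) key

end Master

end Summit.BirchSwinnertonDyer.BirchSwinnertonDyer.Theorems.PrintCf2.RestrictedSelmerPair

end
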